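import Summits.CriticalPhenomena.PercolationContinuityZ3.Theorems.PercNearOneGluingNoHeavyQuantOffersMixture
import Summits.CriticalPhenomena.PercolationContinuityZ3.Theorems.PercNearOneGluingNoHeavyQuantSingleGateColumns
import HarnessLib

/-!
# QUANT lane R8, T-DEC: POOLED OFFERS FOR A FINITE FAMILY — the law-level ONE-BUDGET CERTIFICATE, and its column form for the
# q < 1 slice of `SingleGateConvClosed` with a GENERAL second factor

builds on p205010 (kernel theorem, internal audit signed; external expert review pending)

Support file (`--supports stmt-CriticalPhenomena-4575`), QUANT lane seat prim-quant-arm-2 (gen 34), rung R8 of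
`run/shared/lean/prim/quant/LADDER.md`.  Theorems only (no definitions), standard axioms, no sorries.  Extends lead g29's two-law
`LawDec.flowAtT_mix_of_offers` (`…QuantOffersMixture`) to an arbitrary finite mixture and applies it to the column decomposition of
arm-2 g33's `…QuantSingleGateColumns` (`gateConv_eq_columns`).

WHAT.  Arm-1 g39's offers criterion `flowAtT_of_offers` is AFFINE in the pair (law, routing of the nonzero lows).  Hence for a finite family
of laws `A_i ≥ 0` on `{0..M}` with weights `w_i ≥ 0`, each with a capacity-feasible routing `φ_i` of ITS OWN nonzero lows at a COMMON
`(x, T, j′)`, the mixture `Σ_i w_i·A_i` admits a flow at `(x, T, j′)` as soon as the POOLED offer pays for the POOLED zero atom: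
`T·Σ_i w_i·A_i 0 ≤ Σ_i w_i·offerOf(A_i, φ_i)` (`flowAtT_family_of_offers`; DEC form `decAtT_family_of_offers` for probability laws with
`Σ w = 1`).  This is lead g28's ONE-BUDGET CERTIFICATE (FOR-PROVERS-SINGLE-GATE §5 (ii): "strip each piece's zero atom, Σ_r λ_r·zcap_r ≥ p")
at law level and in closed form: a piece whose own offer exceeds `T·(its zero atom)` lends the surplus to the pieces that fall short; no
cross-piece ROUTING is used (that is the residue this certificate does not see — N96/N98's cross-copy cases).
COLUMN FORM (`gateConv_decAtT_of_columnOffers`).  For the gated convolution of `SingleGateConvClosed`,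
`gate_q(μ₁ ∗ μ₂) = Σ_{s ≤ M₂} μ₂(s)·gate_q(μ₁(· − s))` (arm-2 g33), so: given, for every charged depth `s`, a routing `ψ_s` of the nonzero
lows of the column `gate_q(μ₁(· − s))` at the common `(y, T, j)` on `{0..M₁+M₂}`, and the pooled inequality
`T·(1 − q + q·μ₁(0)·μ₂(0)) ≤ Σ_s μ₂(s)·offerOf(column_s, ψ_s)`, the gated convolution is `DECAtT y T j (M₁+M₂)`; the SGC target
`T = q(T₁ + T₂)` makes every mid above `T` top-affordable (`gateConv_decAtT_of_columnOffers_sgc`).  Reading: the long columns (`s ≥ T₂`)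
are DEC at `T` on their own (`decAtT_longColumn`) and typically carry offer to spare; the certificate asks that this spare offer cover the
short columns' zero deficits — the "target transfer between columns" of g33's reading, in its separable (routing-free) part.
HONEST STATUS: a sufficient criterion only; `SingleGateConvClosed`, `GateMove`, `GatedConvEmptyFree`, `SDECConvClosed`, `TreeDEC`,
`FarTreeRow` remain OPEN; the RATE class log\* and the honest sentence of `run/shared/lean/prim/quant/README.md` are unchanged.

* `LawDec.flowAtT_family_of_offers`, `LawDec.decAtT_family_of_offers` — pooled offers, finite family.
* `LawDec.shiftLaw_laws`, `LawDec.gateShift_laws` — law facts of the columns.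
* `LawDec.gateConv_zero_eq` — the zero atom of the gated convolution, `Σ_s μ₂(s)·gate_q(μ₁(·−s))(0) = 1 − q + q·μ₁(0)·μ₂(0)`.
* **`LawDec.gateConv_decAtT_of_columnOffers`**, `LawDec.gateConv_decAtT_of_columnOffers_sgc` — the column certificate.

[this work]; offers criterion: prim-quant-arm-1 g39; two-law pooled form: prim-quant-lead g29; columns: prim-quant-arm-2 g33 (this lane).
Nothing here is cited as a published result.  The gluing rows served [cite: KozmaNitzan2024, Conjecture 3 (p. 15)]; product measure
[cite: Grimmett1999, §1.3 p. 10].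
-/

noncomputable section

namespace Summit.CriticalPhenomena.PercolationContinuityZ3.Theorems

namespace Quant

open Finset

namespace LawDec

/-! ### Pooled offers for a finite family -/

/-- **POOLED OFFERS CRITERION, FINITE FAMILY.**  `0 < x < 1`, `0 < T`; an index `Fintype ι`, weights `w ≥ 0`, laws `A_i ≥ 0`; mids above
`T` top-affordable (`x·h ≤ T` for `h ≤ j′`, `h ≤ M`, `h > T`); for every `i` a routing `φ_i ≥ 0` of the NONZERO lows of `A_i` at `(x, T, j′)`
on `{0..M}` (allowed pairs only, every nonzero low shipped exactly, every absorber loaded by at most its mass).  If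
`T·Σ_i w_i·A_i 0 ≤ Σ_i w_i·offerOf(A_i, φ_i)`, then `Σ_i w_i·A_i` admits a flow at `(x, T, j′)` on `{0..M}` — `flowAtT_of_offers` for the
pooled routing `Σ_i w_i·φ_i`. [this work] -/
theorem flowAtT_family_of_offers {ι : Type} [Fintype ι] (x T : ℝ) (j' M : ℕ) (w : ι → ℝ) (A : ι → ℕ → ℝ)
    (φ : ι → ℕ → ℕ → ℝ) (hx0 : 0 < x) (hx1 : x < 1) (hT : 0 < T) (hw : ∀ i, 0 ≤ w i) (hA : ∀ i h, 0 ≤ A i h)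
    (hta : ∀ h : ℕ, h ≤ j' → h ≤ M → T < (h : ℝ) → x * (h : ℝ) ≤ T)
    (hφ0 : ∀ i l h, 0 ≤ φ i l h)
    (hφsupp : ∀ i l h, 0 < φ i l h → (1 ≤ l ∧ l ≤ j' ∧ 2 * (l : ℝ) < T) ∧ h ≤ M ∧ (j' + 1 ≤ h ∨ T < (l : ℝ) + h))
    (hφrow : ∀ i (l : ℕ), 1 ≤ l → l ≤ j' → 2 * (l : ℝ) < T → ∑ h ∈ Finset.range (M + 1), φ i l h = A i l)
    (hφcol : ∀ i h, h ≤ M → (j' + 1 ≤ h ∨ T ≤ 2 * (h : ℝ)) → ∑ l ∈ Finset.range (j' + 1), usage x T j' l h * φ i l h ≤ A i h)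
    (hpool : T * ∑ i, w i * A i 0 ≤ ∑ i, w i * offerOf x T j' M (A i) (φ i)) :
    FlowAtT x T j' M (fun h => ∑ i, w i * A i h) := by
  classical
  -- loads of the pooled routing are the pooled loads
  have hload : ∀ h, ∑ l ∈ Finset.range (j' + 1), usage x T j' l h * (∑ i, w i * φ i l h)
      = ∑ i, w i * ∑ l ∈ Finset.range (j' + 1), usage x T j' l h * φ i l h := by
    intro h
    simp only [Finset.mul_sum]
    rw [Finset.sum_comm]
    exact Finset.sum_congr rfl fun i _ => Finset.sum_congr rfl fun l _ => by ring
  refine flowAtT_of_offers x T j' M (fun h => ∑ i, w i * A i h) (fun l h => ∑ i, w i * φ i l h) hx0 hx1 hT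
    (fun h => Finset.sum_nonneg fun i _ => mul_nonneg (hw i) (hA i h)) hta
    (fun l h => Finset.sum_nonneg fun i _ => mul_nonneg (hw i) (hφ0 i l h)) ?_ ?_ ?_ ?_
  · -- support: a positive pooled entry has a positive summand
    intro l h hpos
    obtain ⟨i, _, hi⟩ := Finset.exists_lt_of_sum_lt (by simpa using hpos : ∑ _i : ι, (0 : ℝ) < ∑ i, w i * φ i l h)
    have hφpos : 0 < φ i l h := by
      by_contra hc
      have : φ i l h = 0 := le_antisymm (not_lt.1 hc) (hφ0 i l h)
      rw [this, mul_zero] at hi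
      exact lt_irrefl _ hi
    exact hφsupp i l h hφpos
  · -- rows
    intro l hl1 hlj hlow
    rw [Finset.sum_comm]
    exact Finset.sum_congr rfl fun i _ => by rw [← Finset.mul_sum, hφrow i l hl1 hlj hlow]
  · -- columns
    intro h hhM habs
    rw [hload h]
    exact Finset.sum_le_sum fun i _ => mul_le_mul_of_nonneg_left (hφcol i h hhM habs) (hw i)
  · -- the pooled offer
    have eh : ∀ h : ℕ, (if j' + 1 ≤ h then T * (1 - x) / x else if T < (h : ℝ) then (h : ℝ) - T else 0)
          * ((∑ i, w i * A i h) - ∑ l ∈ Finset.range (j' + 1), usage x T j' l h * (∑ i, w i * φ i l h))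
        = ∑ i, w i * ((if j' + 1 ≤ h then T * (1 - x) / x else if T < (h : ℝ) then (h : ℝ) - T else 0)
          * (A i h - ∑ l ∈ Finset.range (j' + 1), usage x T j' l h * φ i l h)) := by
      intro h
      rw [hload h, ← Finset.sum_sub_distrib, Finset.mul_sum]
      exact Finset.sum_congr rfl fun i _ => by ring
    have e : ∑ h ∈ Finset.range (M + 1),
        (if j' + 1 ≤ h then T * (1 - x) / x else if T < (h : ℝ) then (h : ℝ) - T else 0)
          * ((∑ i, w i * A i h) - ∑ l ∈ Finset.range (j' + 1), usage x T j' l h * (∑ i, w i * φ i l h))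
        = ∑ i, w i * offerOf x T j' M (A i) (φ i) := by
      rw [Finset.sum_congr rfl (fun h _ => eh h), Finset.sum_comm]
      refine Finset.sum_congr rfl fun i _ => ?_
      rw [offerOf, Finset.mul_sum]
    show T * (∑ i, w i * A i 0) ≤ _
    rw [e]
    exact hpool

/-- **POOLED OFFERS CRITERION, FINITE FAMILY, DEC form**: as `flowAtT_family_of_offers` with probability laws `A_i` on `{0..M}`
(nonnegative, vanishing above `M`, mass `1`) and `Σ_i w_i = 1` — then `Σ_i w_i·A_i` is a probability law on `{0..M}` and
`decAtT_of_flowAtT` applies. [this work] -/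
theorem decAtT_family_of_offers {ι : Type} [Fintype ι] (x T : ℝ) (j' M : ℕ) (w : ι → ℝ) (A : ι → ℕ → ℝ)
    (φ : ι → ℕ → ℕ → ℝ) (hx0 : 0 < x) (hx1 : x < 1) (hT : 0 < T) (hw : ∀ i, 0 ≤ w i) (hw1 : ∑ i, w i = 1)
    (hA : ∀ i h, 0 ≤ A i h) (hAM : ∀ i h, M < h → A i h = 0) (hA1 : ∀ i, ∑ h ∈ Finset.range (M + 1), A i h = 1)
    (hta : ∀ h : ℕ, h ≤ j' → h ≤ M → T < (h : ℝ) → x * (h : ℝ) ≤ T)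
    (hφ0 : ∀ i l h, 0 ≤ φ i l h)
    (hφsupp : ∀ i l h, 0 < φ i l h → (1 ≤ l ∧ l ≤ j' ∧ 2 * (l : ℝ) < T) ∧ h ≤ M ∧ (j' + 1 ≤ h ∨ T < (l : ℝ) + h))
    (hφrow : ∀ i (l : ℕ), 1 ≤ l → l ≤ j' → 2 * (l : ℝ) < T → ∑ h ∈ Finset.range (M + 1), φ i l h = A i l)
    (hφcol : ∀ i h, h ≤ M → (j' + 1 ≤ h ∨ T ≤ 2 * (h : ℝ)) → ∑ l ∈ Finset.range (j' + 1), usage x T j' l h * φ i l h ≤ A i h)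
    (hpool : T * ∑ i, w i * A i 0 ≤ ∑ i, w i * offerOf x T j' M (A i) (φ i)) :
    DECAtT x T j' M (fun h => ∑ i, w i * A i h) := by
  refine decAtT_of_flowAtT x T j' M _ hx0 hx1 (fun h hh => ?_) ?_
    (flowAtT_family_of_offers x T j' M w A φ hx0 hx1 hT hw hA hta hφ0 hφsupp hφrow hφcol hpool)
  · exact Finset.sum_eq_zero fun i _ => by rw [hAM i h hh, mul_zero]
  · rw [Finset.sum_comm]
    have e : ∀ i, ∑ h ∈ Finset.range (M + 1), w i * A i h = w i := fun i => by rw [← Finset.mul_sum, hA1 i, mul_one]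
    simp only [e]
    exact hw1

/-! ### The columns of the gated convolution -/

/-- law facts of the shifted law `μ₁(· − s)` on `{0..M}`, `M ≥ M₁ + s`: nonnegative, vanishing above `M`, mass `1`. [this work] -/
theorem shiftLaw_laws (M₁ s M : ℕ) (μ₁ : ℕ → ℝ) (hμ0 : ∀ h, 0 ≤ μ₁ h) (hμM : ∀ h, M₁ < h → μ₁ h = 0)
    (hμ1 : ∑ h ∈ Finset.range (M₁ + 1), μ₁ h = 1) (hM : M₁ + s ≤ M) :
    (∀ h, 0 ≤ (fun t => if s ≤ t then μ₁ (t - s) else 0) h) ∧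
    (∀ h, M < h → (fun t => if s ≤ t then μ₁ (t - s) else 0) h = 0) ∧
    (∑ h ∈ Finset.range (M + 1), (fun t => if s ≤ t then μ₁ (t - s) else 0) h = 1) := by
  refine ⟨fun h => ?_, fun h hh => ?_, ?_⟩
  · show 0 ≤ (if s ≤ h then μ₁ (h - s) else 0)
    split_ifs
    · exact hμ0 _
    · exact le_rfl
  · show (if s ≤ h then μ₁ (h - s) else 0) = 0
    split_ifs with hs
    · exact hμM _ (by omega)
    · rfl
  · show ∑ h ∈ Finset.range (M + 1), (if s ≤ h then μ₁ (h - s) else 0) = 1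
    exact sum_shift_range μ₁ M₁ s M hμM hμ1 (by omega)

/-- law facts of the COLUMN `gate (μ₁(· − s)) q` on `{0..M}` (`0 ≤ q ≤ 1`, `M ≥ M₁ + s`). [this work] -/
theorem gateShift_laws (M₁ s M : ℕ) (μ₁ : ℕ → ℝ) (q : ℝ) (hq0 : 0 ≤ q) (hq1 : q ≤ 1) (hμ0 : ∀ h, 0 ≤ μ₁ h)
    (hμM : ∀ h, M₁ < h → μ₁ h = 0) (hμ1 : ∑ h ∈ Finset.range (M₁ + 1), μ₁ h = 1) (hM : M₁ + s ≤ M) :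
    (∀ h, 0 ≤ gate (fun t => if s ≤ t then μ₁ (t - s) else 0) q h) ∧
    (∀ h, M < h → gate (fun t => if s ≤ t then μ₁ (t - s) else 0) q h = 0) ∧
    (∑ h ∈ Finset.range (M + 1), gate (fun t => if s ≤ t then μ₁ (t - s) else 0) q h = 1) := by
  obtain ⟨h0, hM', h1⟩ := shiftLaw_laws M₁ s M μ₁ hμ0 hμM hμ1 hM
  exact gate_laws M _ q hq0 hq1 h0 hM' h1

/-- **the zero atom of the gated convolution in column form**: `Σ_{s ≤ M₂} μ₂(s)·gate_q(μ₁(· − s))(0) = 1 − q + q·μ₁(0)·μ₂(0)`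
(`μ₂` of mass `1` on `{0..M₂}`). [this work] -/
theorem gateConv_zero_eq (M₂ : ℕ) (μ₁ μ₂ : ℕ → ℝ) (q : ℝ) (hμ₂1 : ∑ s ∈ Finset.range (M₂ + 1), μ₂ s = 1) :
    ∑ s ∈ Finset.range (M₂ + 1), μ₂ s * gate (fun t => if s ≤ t then μ₁ (t - s) else 0) q 0
      = 1 - q + q * μ₁ 0 * μ₂ 0 := by
  have e : ∀ s ∈ Finset.range (M₂ + 1), μ₂ s * gate (fun t => if s ≤ t then μ₁ (t - s) else 0) q 0
      = (1 - q) * μ₂ s + q * μ₁ 0 * (if s = 0 then μ₂ s else 0) := by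
    intro s _
    rw [gate_apply, if_pos rfl]
    by_cases hs : s = 0
    · subst hs; simp
      ring
    · rw [if_neg (by omega), if_neg hs]; ring
  rw [Finset.sum_congr rfl e, Finset.sum_add_distrib, ← Finset.mul_sum, hμ₂1, ← Finset.mul_sum,
    Finset.sum_ite_eq' (Finset.range (M₂ + 1)) 0, if_pos (Finset.mem_range.2 (Nat.succ_pos M₂))]
  ring

/-- **THE COLUMN CERTIFICATE for the q < 1 slice with a GENERAL second factor.**  `0 < y < 1`, `0 ≤ q ≤ 1`, `0 < T`; `μ₁` a probability law on
`{0..M₁}`, `μ₂` one on `{0..M₂}`; mids above `T` top-affordable at `y` up to layer `j` and top `M₁ + M₂`; for every depth `s ≤ M₂` a routing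
`ψ_s` of the NONZERO lows of the column `gate_q(μ₁(· − s))` at `(y, T, j)` on `{0..M₁+M₂}` (only charged depths matter: take `ψ_s = 0`-free
anything feasible elsewhere — feasibility is asked for every `s`).  If the pooled column offers pay for the zero atom of the gated convolution,
`T·(1 − q + q·μ₁(0)·μ₂(0)) ≤ Σ_{s ≤ M₂} μ₂(s)·offerOf(gate_q(μ₁(· − s)), ψ_s)`, then `gate_q(μ₁ ∗ μ₂)` is `DECAtT y T j (M₁+M₂)`. [this work] -/
theorem gateConv_decAtT_of_columnOffers (y q T : ℝ) (j M₁ M₂ : ℕ) (μ₁ μ₂ : ℕ → ℝ) (ψ : ℕ → ℕ → ℕ → ℝ)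
    (hy0 : 0 < y) (hy1 : y < 1) (hq0 : 0 ≤ q) (hq1 : q ≤ 1) (hT : 0 < T)
    (h10 : ∀ h, 0 ≤ μ₁ h) (h1M : ∀ h, M₁ < h → μ₁ h = 0) (h11 : ∑ h ∈ Finset.range (M₁ + 1), μ₁ h = 1)
    (h20 : ∀ h, 0 ≤ μ₂ h) (h21 : ∑ h ∈ Finset.range (M₂ + 1), μ₂ h = 1)
    (hta : ∀ h : ℕ, h ≤ j → h ≤ M₁ + M₂ → T < (h : ℝ) → y * (h : ℝ) ≤ T)
    (hψ0 : ∀ s l h, 0 ≤ ψ s l h)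
    (hψsupp : ∀ s l h, 0 < ψ s l h → (1 ≤ l ∧ l ≤ j ∧ 2 * (l : ℝ) < T) ∧ h ≤ M₁ + M₂ ∧ (j + 1 ≤ h ∨ T < (l : ℝ) + h))
    (hψrow : ∀ s (l : ℕ), s ≤ M₂ → 1 ≤ l → l ≤ j → 2 * (l : ℝ) < T →
      ∑ h ∈ Finset.range (M₁ + M₂ + 1), ψ s l h = gate (fun t => if s ≤ t then μ₁ (t - s) else 0) q l)
    (hψcol : ∀ s h, s ≤ M₂ → h ≤ M₁ + M₂ → (j + 1 ≤ h ∨ T ≤ 2 * (h : ℝ)) →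
      ∑ l ∈ Finset.range (j + 1), usage y T j l h * ψ s l h ≤ gate (fun t => if s ≤ t then μ₁ (t - s) else 0) q h)
    (hpool : T * (1 - q + q * μ₁ 0 * μ₂ 0)
      ≤ ∑ s ∈ Finset.range (M₂ + 1), μ₂ s * offerOf y T j (M₁ + M₂) (gate (fun t => if s ≤ t then μ₁ (t - s) else 0) q) (ψ s)) :
    DECAtT y T j (M₁ + M₂) (gate (lconv M₁ M₂ μ₁ μ₂) q) := by
  -- the gated convolution is the μ₂-mixture of its columns
  have hcol : ∀ h, gate (lconv M₁ M₂ μ₁ μ₂) q h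
      = ∑ s : Fin (M₂ + 1), μ₂ s * gate (fun t => if (s : ℕ) ≤ t then μ₁ (t - s) else 0) q h := by
    intro h
    rw [gateConv_eq_columns M₁ M₂ μ₁ μ₂ q h1M h21 h,
      ← Fin.sum_univ_eq_sum_range (fun s => μ₂ s * gate (fun t => if s ≤ t then μ₁ (t - s) else 0) q h) (M₂ + 1)]
  have e : gate (lconv M₁ M₂ μ₁ μ₂) q = fun h => ∑ s : Fin (M₂ + 1), μ₂ s * gate (fun t => if (s : ℕ) ≤ t then μ₁ (t - s) else 0) q h :=
    funext hcol
  rw [e]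
  -- law facts of the columns (every `s ≤ M₂` has `M₁ + s ≤ M₁ + M₂`)
  have hlaws : ∀ s : Fin (M₂ + 1), (∀ h, 0 ≤ gate (fun t => if (s : ℕ) ≤ t then μ₁ (t - s) else 0) q h) ∧
      (∀ h, M₁ + M₂ < h → gate (fun t => if (s : ℕ) ≤ t then μ₁ (t - s) else 0) q h = 0) ∧
      (∑ h ∈ Finset.range (M₁ + M₂ + 1), gate (fun t => if (s : ℕ) ≤ t then μ₁ (t - s) else 0) q h = 1) :=
    fun s => gateShift_laws M₁ s (M₁ + M₂) μ₁ q hq0 hq1 h10 h1M h11 (by have := s.2; omega)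
  refine decAtT_family_of_offers y T j (M₁ + M₂) (fun s : Fin (M₂ + 1) => μ₂ s)
    (fun s => gate (fun t => if (s : ℕ) ≤ t then μ₁ (t - s) else 0) q) (fun s => ψ s) hy0 hy1 hT (fun s => h20 s) ?_
    (fun s => (hlaws s).1) (fun s => (hlaws s).2.1) (fun s => (hlaws s).2.2) hta (fun s => hψ0 s) (fun s => hψsupp s)
    (fun s l hl1 hlj hlow => hψrow s l (by have := s.2; omega) hl1 hlj hlow)
    (fun s h hhM habs => hψcol s h (by have := s.2; omega) hhM habs) ?_
  · rw [Fin.sum_univ_eq_sum_range (fun s => μ₂ s) (M₂ + 1), h21]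
  · rw [Fin.sum_univ_eq_sum_range (fun s => μ₂ s * gate (fun t => if s ≤ t then μ₁ (t - s) else 0) q 0) (M₂ + 1),
      gateConv_zero_eq M₂ μ₁ μ₂ q h21,
      Fin.sum_univ_eq_sum_range
        (fun s => μ₂ s * offerOf y T j (M₁ + M₂) (gate (fun t => if s ≤ t then μ₁ (t - s) else 0) q) (ψ s)) (M₂ + 1)]
    exact hpool

/-- **THE COLUMN CERTIFICATE AT THE SGC TARGET.**  As `gateConv_decAtT_of_columnOffers` with `T = q·(T₁ + T₂)` (`Tᵢ` the means) under the
top-affordability hypotheses of `SingleGateConvClosed` (`y·Mᵢ ≤ q·Tᵢ`): then every `h ≤ M₁ + M₂` has `y·h ≤ T`, so the mids above `T` are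
top-affordable and only the routings and the pooled inequality remain. [this work] -/
theorem gateConv_decAtT_of_columnOffers_sgc (y q : ℝ) (j M₁ M₂ : ℕ) (μ₁ μ₂ : ℕ → ℝ) (ψ : ℕ → ℕ → ℕ → ℝ)
    (hy0 : 0 < y) (hy1 : y < 1) (hq0 : 0 < q) (hq1 : q ≤ 1)
    (h10 : ∀ h, 0 ≤ μ₁ h) (h1M : ∀ h, M₁ < h → μ₁ h = 0) (h11 : ∑ h ∈ Finset.range (M₁ + 1), μ₁ h = 1)
    (hta1 : y * (M₁ : ℝ) ≤ q * ∑ h ∈ Finset.range (M₁ + 1), (h : ℝ) * μ₁ h)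
    (h20 : ∀ h, 0 ≤ μ₂ h) (h21 : ∑ h ∈ Finset.range (M₂ + 1), μ₂ h = 1)
    (hta2 : y * (M₂ : ℝ) ≤ q * ∑ h ∈ Finset.range (M₂ + 1), (h : ℝ) * μ₂ h)
    (hpos : 0 < ∑ h ∈ Finset.range (M₁ + 1), (h : ℝ) * μ₁ h + ∑ h ∈ Finset.range (M₂ + 1), (h : ℝ) * μ₂ h)
    (hψ0 : ∀ s l h, 0 ≤ ψ s l h)
    (hψsupp : ∀ s l h, 0 < ψ s l h →
      (1 ≤ l ∧ l ≤ j ∧ 2 * (l : ℝ) < q * (∑ h ∈ Finset.range (M₁ + 1), (h : ℝ) * μ₁ h + ∑ h ∈ Finset.range (M₂ + 1), (h : ℝ) * μ₂ h)) ∧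
      h ≤ M₁ + M₂ ∧
      (j + 1 ≤ h ∨ q * (∑ h ∈ Finset.range (M₁ + 1), (h : ℝ) * μ₁ h + ∑ h ∈ Finset.range (M₂ + 1), (h : ℝ) * μ₂ h) < (l : ℝ) + h))
    (hψrow : ∀ s (l : ℕ), s ≤ M₂ → 1 ≤ l → l ≤ j →
      2 * (l : ℝ) < q * (∑ h ∈ Finset.range (M₁ + 1), (h : ℝ) * μ₁ h + ∑ h ∈ Finset.range (M₂ + 1), (h : ℝ) * μ₂ h) →
      ∑ h ∈ Finset.range (M₁ + M₂ + 1), ψ s l h = gate (fun t => if s ≤ t then μ₁ (t - s) else 0) q l)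
    (hψcol : ∀ s h, s ≤ M₂ → h ≤ M₁ + M₂ →
      (j + 1 ≤ h ∨ q * (∑ h ∈ Finset.range (M₁ + 1), (h : ℝ) * μ₁ h + ∑ h ∈ Finset.range (M₂ + 1), (h : ℝ) * μ₂ h) ≤ 2 * (h : ℝ)) →
      ∑ l ∈ Finset.range (j + 1),
        usage y (q * (∑ h ∈ Finset.range (M₁ + 1), (h : ℝ) * μ₁ h + ∑ h ∈ Finset.range (M₂ + 1), (h : ℝ) * μ₂ h)) j l h * ψ s l h
        ≤ gate (fun t => if s ≤ t then μ₁ (t - s) else 0) q h)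
    (hpool : q * (∑ h ∈ Finset.range (M₁ + 1), (h : ℝ) * μ₁ h + ∑ h ∈ Finset.range (M₂ + 1), (h : ℝ) * μ₂ h) * (1 - q + q * μ₁ 0 * μ₂ 0)
      ≤ ∑ s ∈ Finset.range (M₂ + 1), μ₂ s *
        offerOf y (q * (∑ h ∈ Finset.range (M₁ + 1), (h : ℝ) * μ₁ h + ∑ h ∈ Finset.range (M₂ + 1), (h : ℝ) * μ₂ h)) j (M₁ + M₂)
          (gate (fun t => if s ≤ t then μ₁ (t - s) else 0) q) (ψ s)) :
    DECAtT y (q * (∑ h ∈ Finset.range (M₁ + 1), (h : ℝ) * μ₁ h + ∑ h ∈ Finset.range (M₂ + 1), (h : ℝ) * μ₂ h)) j (M₁ + M₂)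
      (gate (lconv M₁ M₂ μ₁ μ₂) q) := by
  set T := q * (∑ h ∈ Finset.range (M₁ + 1), (h : ℝ) * μ₁ h + ∑ h ∈ Finset.range (M₂ + 1), (h : ℝ) * μ₂ h) with hTdef
  have hT : 0 < T := mul_pos hq0 hpos
  have hta : ∀ h : ℕ, h ≤ j → h ≤ M₁ + M₂ → T < (h : ℝ) → y * (h : ℝ) ≤ T := by
    intro h _ hhM _
    have h1 : y * (h : ℝ) ≤ y * ((M₁ + M₂ : ℕ) : ℝ) := mul_le_mul_of_nonneg_left (by exact_mod_cast hhM) hy0.le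
    push_cast at h1
    rw [hTdef]
    nlinarith
  exact gateConv_decAtT_of_columnOffers y q T j M₁ M₂ μ₁ μ₂ ψ hy0 hy1 hq0.le hq1 hT h10 h1M h11 h20 h21 hta hψ0 hψsupp
    hψrow hψcol hpool

end LawDec

end Quant

end Summit.CriticalPhenomena.PercolationContinuityZ3.Theorems
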